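import Summits.ValiantsHypothesis.ValiantsHypothesis.Theorems.BarrierLeverChowThinRowsTwinPeel

/-!
# Route BarrierLever — item `ChowHitsThinRowPartitionMinors` (stmt-ValiantsHypothesis-20195):
# TWIN PEELING IV — the PAIR MOVE: peeling a coordinate with TWO twin pairs

Helper file (`--supports stmt-ValiantsHypothesis-20195`; cell valiant-natproofs, rung V4, 𝒟-side of
door (c); prover seat valiant-natproofs-prover gen 11).  Closes NO item; imports only the seat's
`…ChowThinRowsTwinPeel` (parts I–III; no route file).  Notation (`φ⁰_V`, `B_𝒦`, `E_V`, SPAN,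
POS) as in `…ChowThinRowsTwinPeelSpan`.

THE MOVE (`span_insert_pair`, `posNat_insert_pair`).  Part I's single move `𝒦 = {{c}} ∪ 𝒦'`
resolves at most ONE twin pair `{W, W ∪ c}` along `c` (further PURE carriers `1 + ε y_c` never help).
For a coordinate `c` whose twin pairs sit over TWO bases `w₁ ∋ d`, `w₂ ∌ d` (`d ≠ c` any
coordinate separating the bases) use the TWO forms `1 + y_c` and `1 + y_c + y_d`:
`𝒦 = {{c,d}, {c}} ∪ 𝒦'`.  On squarefree monomials `(1 + y_c)(1 + y_c + y_d) ≡ 1 + 2y_c + y_d + y_c y_d`,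
so for `V ∈ 𝒦'` the leave-one-out vector reads `E_V(W) = (1 + [c ∈ W]) E'_V(W \ c) + [d ∈ W] E'_V((W \ c) \ d)`
— a FIBRE-WEIGHTED lift (weight 1 below, 2 above the twin) plus a `d`-shadow term — while
`E_{cd}(W) = B'(W \ c)` and `E_c(W) = B'(W \ c) + [c ∉ W][d ∈ W] B'(W \ d)`.  If `𝒦'` (avoiding `c`)
has SPAN on the peeled columns `{W \ c}` TOGETHER WITH their `d`-peels `{(W \ c) \ d}`, then `𝒦` has
SPAN on `𝒲`; the proof is an explicit solution (the `d`-shadow enters through a triangular system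
along `X ↦ X \ d`, and the two consistency conditions at the twins are absorbed by the two new
coefficients: `s = a + b` from the twin `w₂`, `b` from the twin `w₁`, using `B'(w₂) ≠ 0`,
`B'(w₁ \ d) ≠ 0`).  POS is carried as «positive integer» (`posNat_insert_pair`), which is what the
weighted lift preserves.  Cost: 2 forms and the `d`-shadow of the peeled family.

Reach and the recursion with both moves: see the companion `…ChowThinRowsTwinPeelAll`.

WHAT THIS IS NOT: no move for three or more twin pairs along every coordinate; nothing on rows of
size 2, on items 20195 / 20172 / 19717 themselves, on crux stmt-ValiantsHypothesis-14610, or on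
`VP` versus `VNP`.
-/

set_option linter.dupNamespace false

namespace Summit.ValiantsHypothesis.ValiantsHypothesis.Theorems.BarrierLever.ChowTwinPeel

open Finset MvPolynomial
open Summit.ValiantsHypothesis.ValiantsHypothesis.Theorems.BarrierLever.ChowSubcube
  (coeff_empty_mul_form coeff_empty_prod_nat)
open Summit.ValiantsHypothesis.ValiantsHypothesis.Theorems.BarrierLever.ChowThinAffine
  (coeff_partitionExpo_oneAddY_mul)

variable {h : ℕ}

/-- For `c ≠ d`, a sum over the members of `W` lying in `{c, d}` has (at most) the two terms `c`, `d`. -/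
theorem sum_filter_mem_pair (W : Finset (Fin h)) (c d : Fin h) (hcd : c ≠ d) (φ : Fin h → ℂ) :
    ∑ x ∈ W with x ∈ (insert c ({d} : Finset (Fin h))), φ x =
      (if c ∈ W then φ c else 0) + (if d ∈ W then φ d else 0) := by
  classical
  rw [Finset.sum_filter]
  have e : ∀ x ∈ W, (if x ∈ (insert c ({d} : Finset (Fin h))) then φ x else 0) =
      (if x = c then φ x else 0) + (if x = d then φ x else 0) := by
    intro x _
    by_cases hxc : x = c
    · subst hxc
      rw [if_pos (Finset.mem_insert_self _ _), if_pos rfl, if_neg hcd, add_zero]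
    · by_cases hxd : x = d
      · subst hxd
        rw [if_pos (Finset.mem_insert_of_mem (Finset.mem_singleton_self _)), if_neg hxc, if_pos rfl,
          zero_add]
      · have hx : x ∉ (insert c ({d} : Finset (Fin h))) := by
          intro hx
          rcases Finset.mem_insert.mp hx with h1 | h2
          · exact hxc h1
          · exact hxd (Finset.mem_singleton.mp h2)
        rw [if_neg hx, if_neg hxc, if_neg hxd, add_zero]
  rw [Finset.sum_congr rfl e, Finset.sum_add_distrib, Finset.sum_ite_eq' W c, Finset.sum_ite_eq' W d]

/-- **Multiplying by the pair form** `φ⁰_{cd} = 1 + y_c + y_d` (`c ≠ d`):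
`coeff_{y^W}(F · φ⁰_{cd}) = F(W) + [c ∈ W] F(W \ c) + [d ∈ W] F(W \ d)` (prover g10's recursion). -/
theorem coeff_mul_form0_pair (F : MvPolynomial (Fin (h + h)) ℂ) (c d : Fin h) (hcd : c ≠ d)
    (W : Finset (Fin h)) :
    coeff (∑ a ∈ (∅ : Finset (Fin h)), Finsupp.single (Fin.castAdd h a) 1 +
        ∑ c' ∈ W, Finsupp.single (Fin.natAdd h c') 1) (F * (C 1 + ∑ a, C ((fun (_ : Fin h) (_ : Finset (Fin h)) => (0 : ℂ)) a (insert c ({d} : Finset (Fin h)))) *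
        X (Fin.castAdd h a) + ∑ c', C (if c' ∈ (insert c ({d} : Finset (Fin h))) then (1 : ℂ) else 0) * X (Fin.natAdd h c') :
          MvPolynomial (Fin (h + h)) ℂ)) =
      coeff (∑ a ∈ (∅ : Finset (Fin h)), Finsupp.single (Fin.castAdd h a) 1 +
        ∑ c' ∈ W, Finsupp.single (Fin.natAdd h c') 1) F +
      ((if c ∈ W then coeff (∑ a ∈ (∅ : Finset (Fin h)), Finsupp.single (Fin.castAdd h a) 1 +
        ∑ c' ∈ W.erase c, Finsupp.single (Fin.natAdd h c') 1) F else 0) +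
       (if d ∈ W then coeff (∑ a ∈ (∅ : Finset (Fin h)), Finsupp.single (Fin.castAdd h a) 1 +
        ∑ c' ∈ W.erase d, Finsupp.single (Fin.natAdd h c') 1) F else 0)) := by
  classical
  have e := coeff_empty_mul_form F (fun a => (fun (_ : Fin h) (_ : Finset (Fin h)) => (0 : ℂ)) a (insert c ({d} : Finset (Fin h))))
    (insert c ({d} : Finset (Fin h))) W
  rw [sum_filter_mem_pair W c d hcd] at e
  exact e

/-- **Multiplying a `c`-free polynomial by the single form written as `φ⁰_{{c}}`**:
`coeff_{y^W}(φ⁰_{{c}} · P) = P(W \ c)`. -/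
theorem coeff_form0_singleton_mul (P : MvPolynomial (Fin (h + h)) ℂ) (c : Fin h)
    (hP : Fin.natAdd h c ∉ P.vars) (W : Finset (Fin h)) :
    coeff (∑ a ∈ (∅ : Finset (Fin h)), Finsupp.single (Fin.castAdd h a) 1 +
        ∑ c' ∈ W, Finsupp.single (Fin.natAdd h c') 1) ((C 1 + ∑ a, C ((fun (_ : Fin h) (_ : Finset (Fin h)) => (0 : ℂ)) a ({c} : Finset (Fin h))) *
        X (Fin.castAdd h a) + ∑ c', C (if c' ∈ ({c} : Finset (Fin h)) then (1 : ℂ) else 0) * X (Fin.natAdd h c') :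
          MvPolynomial (Fin (h + h)) ℂ) * P) =
      coeff (∑ a ∈ (∅ : Finset (Fin h)), Finsupp.single (Fin.castAdd h a) 1 +
        ∑ c' ∈ W.erase c, Finsupp.single (Fin.natAdd h c') 1) P := by
  rw [form0_singleton]
  exact coeff_partitionExpo_oneAddY_mul P c hP ∅ W

/-- Membership facts for the two new forms. -/
theorem pair_not_mem_insert_singleton (𝒦 : Finset (Finset (Fin h))) (c d : Fin h) (hcd : c ≠ d)
    (hfree : ∀ V ∈ 𝒦, c ∉ V) : (insert c ({d} : Finset (Fin h))) ∉ insert ({c} : Finset (Fin h)) 𝒦 := by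
  intro hmem
  rcases Finset.mem_insert.mp hmem with h1 | h2
  · have : d ∈ ({c} : Finset (Fin h)) := h1 ▸ Finset.mem_insert_of_mem (Finset.mem_singleton_self d)
    exact hcd (Finset.mem_singleton.mp this).symm
  · exact hfree _ h2 (Finset.mem_insert_self c _)

/-- **Full product**: `coeff_{y^W} B_𝒦 = (1 + [c ∈ W]) B'(W \ c) + [d ∈ W] B'((W \ c) \ d)` for
`𝒦 = {{c,d},{c}} ∪ 𝒦'`, `B' = B_{𝒦'}`, `𝒦'` avoiding `c`. -/
theorem coeff_prod_insert_pair (𝒦 : Finset (Finset (Fin h))) (c d : Fin h) (hcd : c ≠ d)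
    (hfree : ∀ V ∈ 𝒦, c ∉ V) (W : Finset (Fin h)) :
    coeff (∑ a ∈ (∅ : Finset (Fin h)), Finsupp.single (Fin.castAdd h a) 1 +
        ∑ c' ∈ W, Finsupp.single (Fin.natAdd h c') 1) (∏ V ∈ (insert (insert c ({d} : Finset (Fin h))) (insert ({c} : Finset (Fin h)) 𝒦)), (C 1 + ∑ a, C ((fun (_ : Fin h) (_ : Finset (Fin h)) => (0 : ℂ)) a V) *
        X (Fin.castAdd h a) + ∑ c', C (if c' ∈ V then (1 : ℂ) else 0) * X (Fin.natAdd h c') :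
          MvPolynomial (Fin (h + h)) ℂ)) =
      (1 + (if c ∈ W then 1 else 0)) * coeff (∑ a ∈ (∅ : Finset (Fin h)), Finsupp.single (Fin.castAdd h a) 1 +
        ∑ c' ∈ W.erase c, Finsupp.single (Fin.natAdd h c') 1) (∏ V ∈ 𝒦, (C 1 + ∑ a, C ((fun (_ : Fin h) (_ : Finset (Fin h)) => (0 : ℂ)) a V) *
        X (Fin.castAdd h a) + ∑ c', C (if c' ∈ V then (1 : ℂ) else 0) * X (Fin.natAdd h c') :
          MvPolynomial (Fin (h + h)) ℂ)) +
      (if d ∈ W then coeff (∑ a ∈ (∅ : Finset (Fin h)), Finsupp.single (Fin.castAdd h a) 1 +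
        ∑ c' ∈ (W.erase c).erase d, Finsupp.single (Fin.natAdd h c') 1) (∏ V ∈ 𝒦, (C 1 + ∑ a, C ((fun (_ : Fin h) (_ : Finset (Fin h)) => (0 : ℂ)) a V) *
        X (Fin.castAdd h a) + ∑ c', C (if c' ∈ V then (1 : ℂ) else 0) * X (Fin.natAdd h c') :
          MvPolynomial (Fin (h + h)) ℂ)) else 0) := by
  classical
  rw [Finset.prod_insert (pair_not_mem_insert_singleton 𝒦 c d hcd hfree),
    Finset.prod_insert (singleton_not_mem_of_free 𝒦 c hfree), mul_comm,
    coeff_mul_form0_pair _ c d hcd W,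
    coeff_form0_singleton_mul _ c (natAdd_not_mem_vars_prod 𝒦 c hfree) W]
  by_cases hcW : c ∈ W
  · rw [if_pos hcW, if_pos hcW, coeff_form0_singleton_mul _ c (natAdd_not_mem_vars_prod 𝒦 c hfree),
      Finset.erase_idem]
    by_cases hdW : d ∈ W
    · rw [if_pos hdW, if_pos hdW, coeff_form0_singleton_mul _ c (natAdd_not_mem_vars_prod 𝒦 c hfree),
        Finset.erase_right_comm]
      ring
    · rw [if_neg hdW, if_neg hdW]
      ring
  · rw [if_neg hcW, if_neg hcW]
    by_cases hdW : d ∈ W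
    · rw [if_pos hdW, if_pos hdW, coeff_form0_singleton_mul _ c (natAdd_not_mem_vars_prod 𝒦 c hfree),
        Finset.erase_right_comm]
      ring
    · rw [if_neg hdW, if_neg hdW]
      ring

/-- Leaving out the pair form: `E_{cd} = φ⁰_c · B'`, so `coeff_{y^W} E_{cd} = B'(W \ c)`. -/
theorem coeff_looProd_insert_pair_pair (𝒦 : Finset (Finset (Fin h))) (c d : Fin h) (hcd : c ≠ d)
    (hfree : ∀ V ∈ 𝒦, c ∉ V) (W : Finset (Fin h)) :
    coeff (∑ a ∈ (∅ : Finset (Fin h)), Finsupp.single (Fin.castAdd h a) 1 +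
        ∑ c' ∈ W, Finsupp.single (Fin.natAdd h c') 1) (∏ V' ∈ (insert (insert c ({d} : Finset (Fin h))) (insert ({c} : Finset (Fin h)) 𝒦)).erase (insert c ({d} : Finset (Fin h))), (C 1 + ∑ a, C ((fun (_ : Fin h) (_ : Finset (Fin h)) => (0 : ℂ)) a V') *
        X (Fin.castAdd h a) + ∑ c', C (if c' ∈ V' then (1 : ℂ) else 0) * X (Fin.natAdd h c') :
          MvPolynomial (Fin (h + h)) ℂ)) =
      coeff (∑ a ∈ (∅ : Finset (Fin h)), Finsupp.single (Fin.castAdd h a) 1 +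
        ∑ c' ∈ W.erase c, Finsupp.single (Fin.natAdd h c') 1) (∏ V' ∈ 𝒦, (C 1 + ∑ a, C ((fun (_ : Fin h) (_ : Finset (Fin h)) => (0 : ℂ)) a V') *
        X (Fin.castAdd h a) + ∑ c', C (if c' ∈ V' then (1 : ℂ) else 0) * X (Fin.natAdd h c') :
          MvPolynomial (Fin (h + h)) ℂ)) := by
  classical
  rw [Finset.erase_insert (pair_not_mem_insert_singleton 𝒦 c d hcd hfree)]
  exact coeff_prod_insert_singleton 𝒦 c hfree W

/-- Leaving out the single form: `E_c = φ⁰_{cd} · B'`, so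
`coeff_{y^W} E_c = B'(W \ c) + [c ∉ W][d ∈ W] B'(W \ d)`. -/
theorem coeff_looProd_insert_pair_single (𝒦 : Finset (Finset (Fin h))) (c d : Fin h) (hcd : c ≠ d)
    (hfree : ∀ V ∈ 𝒦, c ∉ V) (W : Finset (Fin h)) :
    coeff (∑ a ∈ (∅ : Finset (Fin h)), Finsupp.single (Fin.castAdd h a) 1 +
        ∑ c' ∈ W, Finsupp.single (Fin.natAdd h c') 1) (∏ V' ∈ (insert (insert c ({d} : Finset (Fin h))) (insert ({c} : Finset (Fin h)) 𝒦)).erase ({c} : Finset (Fin h)), (C 1 + ∑ a, C ((fun (_ : Fin h) (_ : Finset (Fin h)) => (0 : ℂ)) a V') *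
        X (Fin.castAdd h a) + ∑ c', C (if c' ∈ V' then (1 : ℂ) else 0) * X (Fin.natAdd h c') :
          MvPolynomial (Fin (h + h)) ℂ)) =
      coeff (∑ a ∈ (∅ : Finset (Fin h)), Finsupp.single (Fin.castAdd h a) 1 +
        ∑ c' ∈ W.erase c, Finsupp.single (Fin.natAdd h c') 1) (∏ V' ∈ 𝒦, (C 1 + ∑ a, C ((fun (_ : Fin h) (_ : Finset (Fin h)) => (0 : ℂ)) a V') *
        X (Fin.castAdd h a) + ∑ c', C (if c' ∈ V' then (1 : ℂ) else 0) * X (Fin.natAdd h c') :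
          MvPolynomial (Fin (h + h)) ℂ)) +
      (if c ∉ W ∧ d ∈ W then coeff (∑ a ∈ (∅ : Finset (Fin h)), Finsupp.single (Fin.castAdd h a) 1 +
        ∑ c' ∈ W.erase d, Finsupp.single (Fin.natAdd h c') 1) (∏ V' ∈ 𝒦, (C 1 + ∑ a, C ((fun (_ : Fin h) (_ : Finset (Fin h)) => (0 : ℂ)) a V') *
        X (Fin.castAdd h a) + ∑ c', C (if c' ∈ V' then (1 : ℂ) else 0) * X (Fin.natAdd h c') :
          MvPolynomial (Fin (h + h)) ℂ)) else 0) := by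
  classical
  have hne : ((insert c ({d} : Finset (Fin h))) : Finset (Fin h)) ≠ {c} := by
    intro e
    have : d ∈ ({c} : Finset (Fin h)) := e ▸ Finset.mem_insert_of_mem (Finset.mem_singleton_self d)
    exact hcd (Finset.mem_singleton.mp this).symm
  rw [Finset.erase_insert_of_ne hne, Finset.erase_insert (singleton_not_mem_of_free 𝒦 c hfree),
    Finset.prod_insert (fun hm => hfree _ hm (Finset.mem_insert_self c _)), mul_comm,
    coeff_mul_form0_pair _ c d hcd W]
  have hcf := natAdd_not_mem_vars_prod 𝒦 c hfree
  by_cases hcW : c ∈ W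
  · rw [if_pos hcW, coeff_eq_zero_of_natAdd_not_mem_vars _ c hcf W hcW, zero_add,
      if_neg (show ¬(c ∉ W ∧ d ∈ W) from fun h' => h'.1 hcW)]
    by_cases hdW : d ∈ W
    · rw [if_pos hdW, coeff_eq_zero_of_natAdd_not_mem_vars _ c hcf (W.erase d)
        (Finset.mem_erase.mpr ⟨hcd, hcW⟩)]
    · rw [if_neg hdW]
  · rw [if_neg hcW, Finset.erase_eq_of_notMem hcW, zero_add]
    by_cases hdW : d ∈ W
    · rw [if_pos hdW, if_pos ⟨hcW, hdW⟩]
    · rw [if_neg hdW, if_neg (fun h' => hdW h'.2)]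

/-- Leaving out an old form `V ∈ 𝒦'`: `E_V = φ⁰_{cd} φ⁰_c E'_V`, so
`coeff_{y^W} E_V = (1 + [c ∈ W]) E'_V(W \ c) + [d ∈ W] E'_V((W \ c) \ d)`. -/
theorem coeff_looProd_insert_pair_of_mem (𝒦 : Finset (Finset (Fin h))) (c d : Fin h) (hcd : c ≠ d)
    (hfree : ∀ V ∈ 𝒦, c ∉ V) (V : Finset (Fin h)) (hV : V ∈ 𝒦) (W : Finset (Fin h)) :
    coeff (∑ a ∈ (∅ : Finset (Fin h)), Finsupp.single (Fin.castAdd h a) 1 +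
        ∑ c' ∈ W, Finsupp.single (Fin.natAdd h c') 1) (∏ V' ∈ (insert (insert c ({d} : Finset (Fin h))) (insert ({c} : Finset (Fin h)) 𝒦)).erase V, (C 1 + ∑ a, C ((fun (_ : Fin h) (_ : Finset (Fin h)) => (0 : ℂ)) a V') *
        X (Fin.castAdd h a) + ∑ c', C (if c' ∈ V' then (1 : ℂ) else 0) * X (Fin.natAdd h c') :
          MvPolynomial (Fin (h + h)) ℂ)) =
      (1 + (if c ∈ W then 1 else 0)) * coeff (∑ a ∈ (∅ : Finset (Fin h)), Finsupp.single (Fin.castAdd h a) 1 +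
        ∑ c' ∈ W.erase c, Finsupp.single (Fin.natAdd h c') 1) (∏ V' ∈ 𝒦.erase V, (C 1 + ∑ a, C ((fun (_ : Fin h) (_ : Finset (Fin h)) => (0 : ℂ)) a V') *
        X (Fin.castAdd h a) + ∑ c', C (if c' ∈ V' then (1 : ℂ) else 0) * X (Fin.natAdd h c') :
          MvPolynomial (Fin (h + h)) ℂ)) +
      (if d ∈ W then coeff (∑ a ∈ (∅ : Finset (Fin h)), Finsupp.single (Fin.castAdd h a) 1 +
        ∑ c' ∈ (W.erase c).erase d, Finsupp.single (Fin.natAdd h c') 1) (∏ V' ∈ 𝒦.erase V, (C 1 + ∑ a, C ((fun (_ : Fin h) (_ : Finset (Fin h)) => (0 : ℂ)) a V') *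
        X (Fin.castAdd h a) + ∑ c', C (if c' ∈ V' then (1 : ℂ) else 0) * X (Fin.natAdd h c') :
          MvPolynomial (Fin (h + h)) ℂ)) else 0) := by
  classical
  have hVc : V ≠ {c} := fun e => hfree V hV (e ▸ Finset.mem_singleton_self c)
  have hVcd : V ≠ (insert c ({d} : Finset (Fin h))) := fun e => hfree V hV (e ▸ Finset.mem_insert_self c _)
  rw [Finset.erase_insert_of_ne (Ne.symm hVcd), Finset.erase_insert_of_ne (Ne.symm hVc)]
  exact coeff_prod_insert_pair (𝒦.erase V) c d hcd
    (fun V' hV' => hfree V' (Finset.mem_of_mem_erase hV')) W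

/-- **POS lifts through the pair move**, in the positive-integer form needed downstream: if
`B'(W \ c)` is a positive integer for every column, so is `coeff_{y^W} B_𝒦`. -/
theorem posNat_insert_pair (𝒦 : Finset (Finset (Fin h))) (c d : Fin h) (hcd : c ≠ d)
    (hfree : ∀ V ∈ 𝒦, c ∉ V) (𝒲 : Finset (Finset (Fin h)))
    (hpos : ∀ W ∈ 𝒲, ∃ n : ℕ, 1 ≤ n ∧ coeff (∑ a ∈ (∅ : Finset (Fin h)), Finsupp.single (Fin.castAdd h a) 1 +
        ∑ c' ∈ W.erase c, Finsupp.single (Fin.natAdd h c') 1) (∏ V ∈ 𝒦, (C 1 + ∑ a, C ((fun (_ : Fin h) (_ : Finset (Fin h)) => (0 : ℂ)) a V) *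
        X (Fin.castAdd h a) + ∑ c', C (if c' ∈ V then (1 : ℂ) else 0) * X (Fin.natAdd h c') :
          MvPolynomial (Fin (h + h)) ℂ)) = (n : ℂ)) :
    ∀ W ∈ 𝒲, ∃ n : ℕ, 1 ≤ n ∧ coeff (∑ a ∈ (∅ : Finset (Fin h)), Finsupp.single (Fin.castAdd h a) 1 +
        ∑ c' ∈ W, Finsupp.single (Fin.natAdd h c') 1) (∏ V ∈ (insert (insert c ({d} : Finset (Fin h))) (insert ({c} : Finset (Fin h)) 𝒦)), (C 1 + ∑ a, C ((fun (_ : Fin h) (_ : Finset (Fin h)) => (0 : ℂ)) a V) *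
        X (Fin.castAdd h a) + ∑ c', C (if c' ∈ V then (1 : ℂ) else 0) * X (Fin.natAdd h c') :
          MvPolynomial (Fin (h + h)) ℂ)) = (n : ℂ) := by
  classical
  intro W hW
  obtain ⟨n₁, hn₁, e₁⟩ := hpos W hW
  obtain ⟨n₂, e₂, _⟩ := coeff_empty_prod_nat (fun (_ : Fin h) (_ : Finset (Fin h)) => (0 : ℂ)) 𝒦
    ((W.erase c).erase d)
  refine ⟨(1 + (if c ∈ W then 1 else 0)) * n₁ + (if d ∈ W then n₂ else 0), ?_, ?_⟩
  · have : 1 ≤ (1 + (if c ∈ W then 1 else 0)) * n₁ := by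
      split_ifs <;> omega
    omega
  · rw [coeff_prod_insert_pair 𝒦 c d hcd hfree W, e₁, e₂]
    split_ifs <;> push_cast <;> ring

/-- **SPAN lifts through the pair move (κ = 2 twin peeling)**: `c ≠ d`, `𝒦'` avoids `c`, the
twin bases along `c` are among `w₁ ∋ d`, `w₂ ∌ d`; SPAN of `𝒦'` on `{W \ c}` and on `{(W \ c) \ d}`
plus `B'(w₁ \ d) ≠ 0 ≠ B'(w₂)` give SPAN of `{{c,d},{c}} ∪ 𝒦'` on `𝒲` (explicit solution: pair form
`a = s - b`, single form `b`, old forms represent `f`; see the module docstring). -/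
theorem span_insert_pair (𝒦 : Finset (Finset (Fin h))) (c d : Fin h) (hcd : c ≠ d)
    (hfree : ∀ V ∈ 𝒦, c ∉ V) (𝒲 : Finset (Finset (Fin h))) (w₁ w₂ : Finset (Fin h))
    (hdw₁ : d ∈ w₁) (hdw₂ : d ∉ w₂)
    (htwin : ∀ W ∈ 𝒲, c ∉ W → insert c W ∈ 𝒲 → W = w₁ ∨ W = w₂)
    (hB₁ : coeff (∑ a ∈ (∅ : Finset (Fin h)), Finsupp.single (Fin.castAdd h a) 1 +
        ∑ c' ∈ w₁.erase d, Finsupp.single (Fin.natAdd h c') 1) (∏ V ∈ 𝒦, (C 1 + ∑ a, C ((fun (_ : Fin h) (_ : Finset (Fin h)) => (0 : ℂ)) a V) *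
        X (Fin.castAdd h a) + ∑ c', C (if c' ∈ V then (1 : ℂ) else 0) * X (Fin.natAdd h c') :
          MvPolynomial (Fin (h + h)) ℂ)) ≠ 0)
    (hB₂ : coeff (∑ a ∈ (∅ : Finset (Fin h)), Finsupp.single (Fin.castAdd h a) 1 +
        ∑ c' ∈ w₂, Finsupp.single (Fin.natAdd h c') 1) (∏ V ∈ 𝒦, (C 1 + ∑ a, C ((fun (_ : Fin h) (_ : Finset (Fin h)) => (0 : ℂ)) a V) *
        X (Fin.castAdd h a) + ∑ c', C (if c' ∈ V then (1 : ℂ) else 0) * X (Fin.natAdd h c') :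
          MvPolynomial (Fin (h + h)) ℂ)) ≠ 0)
    (hspan : ∀ g : Finset (Fin h) → ℂ, ∃ cV : Finset (Fin h) → ℂ,
      (∀ W ∈ 𝒲, ∑ V ∈ 𝒦, cV V * coeff (∑ a ∈ (∅ : Finset (Fin h)), Finsupp.single (Fin.castAdd h a) 1 +
        ∑ c' ∈ W.erase c, Finsupp.single (Fin.natAdd h c') 1) (∏ V' ∈ 𝒦.erase V, (C 1 + ∑ a, C ((fun (_ : Fin h) (_ : Finset (Fin h)) => (0 : ℂ)) a V') *
        X (Fin.castAdd h a) + ∑ c', C (if c' ∈ V' then (1 : ℂ) else 0) * X (Fin.natAdd h c') :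
          MvPolynomial (Fin (h + h)) ℂ)) = g (W.erase c)) ∧
      (∀ W ∈ 𝒲, ∑ V ∈ 𝒦, cV V * coeff (∑ a ∈ (∅ : Finset (Fin h)), Finsupp.single (Fin.castAdd h a) 1 +
        ∑ c' ∈ (W.erase c).erase d, Finsupp.single (Fin.natAdd h c') 1) (∏ V' ∈ 𝒦.erase V, (C 1 + ∑ a, C ((fun (_ : Fin h) (_ : Finset (Fin h)) => (0 : ℂ)) a V') *
        X (Fin.castAdd h a) + ∑ c', C (if c' ∈ V' then (1 : ℂ) else 0) * X (Fin.natAdd h c') :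
          MvPolynomial (Fin (h + h)) ℂ)) =
        g ((W.erase c).erase d))) :
    ∀ g : Finset (Fin h) → ℂ, ∃ cV : Finset (Fin h) → ℂ, ∀ W ∈ 𝒲,
      ∑ V ∈ (insert (insert c ({d} : Finset (Fin h))) (insert ({c} : Finset (Fin h)) 𝒦)), cV V * coeff (∑ a ∈ (∅ : Finset (Fin h)), Finsupp.single (Fin.castAdd h a) 1 +
        ∑ c' ∈ W, Finsupp.single (Fin.natAdd h c') 1) (∏ V' ∈ (insert (insert c ({d} : Finset (Fin h))) (insert ({c} : Finset (Fin h)) 𝒦)).erase V, (C 1 + ∑ a, C ((fun (_ : Fin h) (_ : Finset (Fin h)) => (0 : ℂ)) a V') *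
        X (Fin.castAdd h a) + ∑ c', C (if c' ∈ V' then (1 : ℂ) else 0) * X (Fin.natAdd h c') :
          MvPolynomial (Fin (h + h)) ℂ)) = g W := by
  classical
  intro g
  set B : Finset (Fin h) → ℂ := fun Y' => coeff (∑ a ∈ (∅ : Finset (Fin h)),
      Finsupp.single (Fin.castAdd h a) 1 + ∑ c' ∈ Y', Finsupp.single (Fin.natAdd h c') 1)
    (∏ V ∈ 𝒦, (C 1 + ∑ a, C ((fun (_ : Fin h) (_ : Finset (Fin h)) => (0 : ℂ)) a V) *
        X (Fin.castAdd h a) + ∑ c', C (if c' ∈ V then (1 : ℂ) else 0) * X (Fin.natAdd h c') :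
          MvPolynomial (Fin (h + h)) ℂ)) with hB
  have hB₁' : B (w₁.erase d) ≠ 0 := hB₁
  have hB₂' : B w₂ ≠ 0 := hB₂
  set s : ℂ := (2 * g w₂ - g (insert c w₂)) / B w₂ with hs
  set f₀ : Finset (Fin h) → ℂ := fun Y =>
    if Y ∈ 𝒲 then g Y - s * B Y else if insert c Y ∈ 𝒲 then (g (insert c Y) - s * B Y) / 2 else 0
    with hf₀
  set b : ℂ := (2 * g w₁ - g (insert c w₁) - s * B w₁ - f₀ (w₁.erase d)) / (2 * B (w₁.erase d)) with hb
  set a : ℂ := s - b with ha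
  set f : Finset (Fin h) → ℂ := fun Y =>
    if Y ∈ 𝒲 then g Y - (if d ∈ Y then f₀ (Y.erase d) + b * B (Y.erase d) else 0) - s * B Y
    else if insert c Y ∈ 𝒲 then (g (insert c Y) - (if d ∈ Y then f₀ (Y.erase d) else 0) - s * B Y) / 2
    else 0 with hf
  -- on `d`-free sets `f = f₀`
  have hff₀ : ∀ Y, d ∉ Y → f Y = f₀ Y := by
    intro Y hdY
    simp only [hf, hf₀, if_neg hdY, sub_zero]
  obtain ⟨cV', h1, h2⟩ := hspan f
  refine ⟨fun V => if V = (insert c ({d} : Finset (Fin h))) then a else if V = ({c} : Finset (Fin h)) then b else cV' V,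
    fun W hW => ?_⟩
  have hne : ((insert c ({d} : Finset (Fin h))) : Finset (Fin h)) ≠ {c} := by
    intro e
    have : d ∈ ({c} : Finset (Fin h)) := e ▸ Finset.mem_insert_of_mem (Finset.mem_singleton_self d)
    exact hcd (Finset.mem_singleton.mp this).symm
  rw [Finset.sum_insert (pair_not_mem_insert_singleton 𝒦 c d hcd hfree),
    Finset.sum_insert (singleton_not_mem_of_free 𝒦 c hfree)]
  dsimp only
  rw [if_pos rfl, if_neg (Ne.symm hne), if_pos rfl,
    coeff_looProd_insert_pair_pair 𝒦 c d hcd hfree W,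
    coeff_looProd_insert_pair_single 𝒦 c d hcd hfree W]
  have hrest : ∑ V ∈ 𝒦, (if V = (insert c ({d} : Finset (Fin h))) then a else if V = ({c} : Finset (Fin h)) then b else cV' V) *
      coeff (∑ a ∈ (∅ : Finset (Fin h)), Finsupp.single (Fin.castAdd h a) 1 +
        ∑ c' ∈ W, Finsupp.single (Fin.natAdd h c') 1) (∏ V' ∈ (insert (insert c ({d} : Finset (Fin h))) (insert ({c} : Finset (Fin h)) 𝒦)).erase V, (C 1 + ∑ a, C ((fun (_ : Fin h) (_ : Finset (Fin h)) => (0 : ℂ)) a V') *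
        X (Fin.castAdd h a) + ∑ c', C (if c' ∈ V' then (1 : ℂ) else 0) * X (Fin.natAdd h c') :
          MvPolynomial (Fin (h + h)) ℂ)) =
      (1 + (if c ∈ W then 1 else 0)) * f (W.erase c) +
      (if d ∈ W then f ((W.erase c).erase d) else 0) := by
    rw [← h1 W hW, ← h2 W hW]
    have e : ∀ V ∈ 𝒦, (if V = (insert c ({d} : Finset (Fin h))) then a else if V = ({c} : Finset (Fin h)) then b else cV' V) *
        coeff (∑ a ∈ (∅ : Finset (Fin h)), Finsupp.single (Fin.castAdd h a) 1 +
        ∑ c' ∈ W, Finsupp.single (Fin.natAdd h c') 1) (∏ V' ∈ (insert (insert c ({d} : Finset (Fin h))) (insert ({c} : Finset (Fin h)) 𝒦)).erase V, (C 1 + ∑ a, C ((fun (_ : Fin h) (_ : Finset (Fin h)) => (0 : ℂ)) a V') *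
        X (Fin.castAdd h a) + ∑ c', C (if c' ∈ V' then (1 : ℂ) else 0) * X (Fin.natAdd h c') :
          MvPolynomial (Fin (h + h)) ℂ)) =
        (1 + (if c ∈ W then 1 else 0)) * (cV' V * coeff (∑ a ∈ (∅ : Finset (Fin h)), Finsupp.single (Fin.castAdd h a) 1 +
        ∑ c' ∈ W.erase c, Finsupp.single (Fin.natAdd h c') 1) (∏ V' ∈ 𝒦.erase V, (C 1 + ∑ a, C ((fun (_ : Fin h) (_ : Finset (Fin h)) => (0 : ℂ)) a V') *
        X (Fin.castAdd h a) + ∑ c', C (if c' ∈ V' then (1 : ℂ) else 0) * X (Fin.natAdd h c') :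
          MvPolynomial (Fin (h + h)) ℂ))) +
        (if d ∈ W then cV' V * coeff (∑ a ∈ (∅ : Finset (Fin h)), Finsupp.single (Fin.castAdd h a) 1 +
        ∑ c' ∈ (W.erase c).erase d, Finsupp.single (Fin.natAdd h c') 1) (∏ V' ∈ 𝒦.erase V, (C 1 + ∑ a, C ((fun (_ : Fin h) (_ : Finset (Fin h)) => (0 : ℂ)) a V') *
        X (Fin.castAdd h a) + ∑ c', C (if c' ∈ V' then (1 : ℂ) else 0) * X (Fin.natAdd h c') :
          MvPolynomial (Fin (h + h)) ℂ)) else 0) := by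
      intro V hV
      have hVc : V ≠ {c} := fun e => hfree V hV (e ▸ Finset.mem_singleton_self c)
      have hVcd : V ≠ (insert c ({d} : Finset (Fin h))) := fun e => hfree V hV (e ▸ Finset.mem_insert_self c _)
      rw [if_neg hVcd, if_neg hVc, coeff_looProd_insert_pair_of_mem 𝒦 c d hcd hfree V hV W]
      split_ifs <;> ring
    rw [Finset.sum_congr rfl e, Finset.sum_add_distrib, ← Finset.mul_sum]
    congr 1
    split_ifs
    · rfl
    · exact Finset.sum_const_zero
  rw [hrest]
  -- case analysis on the column `W`
  by_cases hcW : c ∈ W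
  · -- upper column `W = X ∪ c`
    set Xc := W.erase c with hXc
    have hWX : insert c Xc = W := Finset.insert_erase hcW
    have hcX : c ∉ Xc := Finset.notMem_erase c W
    rw [if_pos hcW, if_neg (show ¬(c ∉ W ∧ d ∈ W) from fun h' => h'.1 hcW)]
    by_cases hXW : Xc ∈ 𝒲
    · -- twin: `Xc = w₁` or `Xc = w₂`
      rcases htwin Xc hXW hcX (hWX ▸ hW) with hX1 | hX2
      · -- Xc = w₁ ∋ d
        have hdX : d ∈ Xc := by rw [hX1]; exact hdw₁
        have hdW : d ∈ W := Finset.mem_of_mem_erase hdX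
        have hfX : f Xc = g Xc - (f₀ (Xc.erase d) + b * B (Xc.erase d)) - s * B Xc := by
          simp only [hf, if_pos hXW, if_pos hdX]
        rw [hfX, if_pos hdW, hff₀ _ (Finset.notMem_erase d Xc), ← hWX, hX1, ha, hb]
        field_simp
        ring
      · -- Xc = w₂ ∌ d
        have hdX : d ∉ Xc := by rw [hX2]; exact hdw₂
        have hdW : d ∉ W := fun h' => hdX (Finset.mem_erase.mpr ⟨Ne.symm hcd, h'⟩)
        have hfX : f Xc = g Xc - s * B Xc := by
          simp only [hf, if_pos hXW, if_neg hdX, sub_zero]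
        rw [hfX, if_neg hdW, ← hWX, hX2, ha, hs]
        field_simp
        ring
    · -- upper only
      have hins : insert c Xc ∈ 𝒲 := hWX ▸ hW
      have hfX : f Xc = (g (insert c Xc) - (if d ∈ Xc then f₀ (Xc.erase d) else 0) - s * B Xc) / 2 := by
        simp only [hf, if_neg hXW, if_pos hins]
      rw [hfX, hWX]
      by_cases hdW : d ∈ W
      · have hdX : d ∈ Xc := Finset.mem_erase.mpr ⟨Ne.symm hcd, hdW⟩
        rw [if_pos hdX, if_pos hdW, hff₀ _ (Finset.notMem_erase d Xc), ha]
        ring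
      · have hdX : d ∉ Xc := fun h' => hdW (Finset.mem_of_mem_erase h')
        rw [if_neg hdX, if_neg hdW, ha]
        ring
  · -- lower column `W` (`c ∉ W`)
    rw [if_neg hcW, Finset.erase_eq_of_notMem hcW]
    have hfW : f W = g W - (if d ∈ W then f₀ (W.erase d) + b * B (W.erase d) else 0) - s * B W := by
      simp only [hf, if_pos hW]
    rw [hfW]
    by_cases hdW : d ∈ W
    · rw [if_pos hdW, if_pos ⟨hcW, hdW⟩, if_pos hdW, hff₀ _ (Finset.notMem_erase d W), ha]
      ring
    · rw [if_neg hdW, if_neg (fun h' => hdW h'.2), if_neg hdW, ha]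
      ring


end Summit.ValiantsHypothesis.ValiantsHypothesis.Theorems.BarrierLever.ChowTwinPeel
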